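import Mathlib
import Summits.Ventures.PercRepro2.CoinChainXAGeneralGate

/-!
# The (j, j′) markers: set-level facts on the fibres of `E = {m, j, j'}`, part G
(blind cell PercRepro2, night-2 g28; proofs/NIGHT2-DARC.md §70)

Each fact is one `ad_sets_dec` application to the laws `νc`, `νd` (or `νd`, `νd'` / `νd'`, `νd'` for the gate facts) on
unions of the eight fibres (`ent = {m}`, `ent' = {j, j'}`), with the membership logic of the three literals written out.
-/

namespace Summit.Ventures.PercRepro2.Coin

open Classical

section JpGateFacts

variable {V : Type*} [DecidableEq V] {R : Type*} [Field R] [LinearOrder R] [IsStrictOrderedRing R]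

/-- Monotonicity of the gate's relative openness: `u_jj'·w_j ≤ u_j·w_jj'`. -/
lemma jp_mono_j (U : Finset V) (m j j' : V)
    (ν d d' : Finset V → R)
    (hν0 : ∀ W, 0 ≤ ν W) (hν : ∀ s ⊆ U, ∀ t ⊆ U, ν s * ν t ≤ ν (s ∩ t) * ν (s ∪ t))
    (hd0 : ∀ W, 0 ≤ d W) (hd'0 : ∀ W, 0 ≤ d' W)
    (hdd' : ∀ s t, d s * d' t ≤ d (s ∩ t) * d' (s ∪ t)) :
    (∑ W ∈ U.powerset.filter (fun W => m ∉ W ∧ j ∈ W ∧ j' ∈ W), ν W * d W) * (∑ W ∈ U.powerset.filter (fun W => m ∉ W ∧ j ∈ W ∧ j' ∉ W), ν W * d' W) ≤ (∑ W ∈ U.powerset.filter (fun W => m ∉ W ∧ j ∈ W ∧ j' ∉ W), ν W * d W) * (∑ W ∈ U.powerset.filter (fun W => m ∉ W ∧ j ∈ W ∧ j' ∈ W), ν W * d' W) := by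
  have h := ad_sets_dec U (fun W => ν W * d W) (fun W => ν W * d' W) (fun W => ν W * d W) (fun W => ν W * d' W)
    (fun W => mul_nonneg (hν0 W) (hd0 W)) (fun W => mul_nonneg (hν0 W) (hd'0 W)) (fun W => mul_nonneg (hν0 W) (hd0 W)) (fun W => mul_nonneg (hν0 W) (hd'0 W))
    (fun W => (m ∉ W ∧ j ∈ W ∧ j' ∈ W)) (fun W => (m ∉ W ∧ j ∈ W ∧ j' ∉ W)) (fun W => (m ∉ W ∧ j ∈ W ∧ j' ∉ W)) (fun W => (m ∉ W ∧ j ∈ W ∧ j' ∈ W))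
    (fun s hs t ht hA hB => by
      exact ⟨⟨(fun hh => hA.1 (Finset.mem_inter.1 hh).1), (Finset.mem_inter.2 ⟨hA.2.1, hB.2.1⟩), (fun hh => hB.2.2 (Finset.mem_inter.1 hh).2)⟩, ⟨(fun hh => (Finset.mem_union.1 hh).elim hA.1 hB.1), (Finset.mem_union_left _ hA.2.1), (Finset.mem_union_left _ hA.2.2)⟩, six_pw_dw U ν d d' hν0 hν hd0 hd'0 hdd' s hs t ht⟩)
  exact h

/-- Monotonicity of the gate's relative openness: `u_jj'·w_j' ≤ u_j'·w_jj'`. -/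
lemma jp_mono_jp (U : Finset V) (m j j' : V)
    (ν d d' : Finset V → R)
    (hν0 : ∀ W, 0 ≤ ν W) (hν : ∀ s ⊆ U, ∀ t ⊆ U, ν s * ν t ≤ ν (s ∩ t) * ν (s ∪ t))
    (hd0 : ∀ W, 0 ≤ d W) (hd'0 : ∀ W, 0 ≤ d' W)
    (hdd' : ∀ s t, d s * d' t ≤ d (s ∩ t) * d' (s ∪ t)) :
    (∑ W ∈ U.powerset.filter (fun W => m ∉ W ∧ j ∈ W ∧ j' ∈ W), ν W * d W) * (∑ W ∈ U.powerset.filter (fun W => m ∉ W ∧ j ∉ W ∧ j' ∈ W), ν W * d' W) ≤ (∑ W ∈ U.powerset.filter (fun W => m ∉ W ∧ j ∉ W ∧ j' ∈ W), ν W * d W) * (∑ W ∈ U.powerset.filter (fun W => m ∉ W ∧ j ∈ W ∧ j' ∈ W), ν W * d' W) := by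
  have h := ad_sets_dec U (fun W => ν W * d W) (fun W => ν W * d' W) (fun W => ν W * d W) (fun W => ν W * d' W)
    (fun W => mul_nonneg (hν0 W) (hd0 W)) (fun W => mul_nonneg (hν0 W) (hd'0 W)) (fun W => mul_nonneg (hν0 W) (hd0 W)) (fun W => mul_nonneg (hν0 W) (hd'0 W))
    (fun W => (m ∉ W ∧ j ∈ W ∧ j' ∈ W)) (fun W => (m ∉ W ∧ j ∉ W ∧ j' ∈ W)) (fun W => (m ∉ W ∧ j ∉ W ∧ j' ∈ W)) (fun W => (m ∉ W ∧ j ∈ W ∧ j' ∈ W))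
    (fun s hs t ht hA hB => by
      exact ⟨⟨(fun hh => hA.1 (Finset.mem_inter.1 hh).1), (fun hh => hB.2.1 (Finset.mem_inter.1 hh).2), (Finset.mem_inter.2 ⟨hA.2.2, hB.2.2⟩)⟩, ⟨(fun hh => (Finset.mem_union.1 hh).elim hA.1 hB.1), (Finset.mem_union_left _ hA.2.1), (Finset.mem_union_left _ hA.2.2)⟩, six_pw_dw U ν d d' hν0 hν hd0 hd'0 hdd' s hs t ht⟩)
  exact h

/-- The bound by the top fibre: `u_mjj'·w_mj ≤ u_mj·w_mjj'`. -/
lemma jp_top_mj (U : Finset V) (m j j' : V)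
    (ν d d' : Finset V → R)
    (hν0 : ∀ W, 0 ≤ ν W) (hν : ∀ s ⊆ U, ∀ t ⊆ U, ν s * ν t ≤ ν (s ∩ t) * ν (s ∪ t))
    (hd0 : ∀ W, 0 ≤ d W) (hd'0 : ∀ W, 0 ≤ d' W)
    (hdd' : ∀ s t, d s * d' t ≤ d (s ∩ t) * d' (s ∪ t)) :
    (∑ W ∈ U.powerset.filter (fun W => m ∈ W ∧ j ∈ W ∧ j' ∈ W), ν W * d W) * (∑ W ∈ U.powerset.filter (fun W => m ∈ W ∧ j ∈ W ∧ j' ∉ W), ν W * d' W) ≤ (∑ W ∈ U.powerset.filter (fun W => m ∈ W ∧ j ∈ W ∧ j' ∉ W), ν W * d W) * (∑ W ∈ U.powerset.filter (fun W => m ∈ W ∧ j ∈ W ∧ j' ∈ W), ν W * d' W) := by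
  have h := ad_sets_dec U (fun W => ν W * d W) (fun W => ν W * d' W) (fun W => ν W * d W) (fun W => ν W * d' W)
    (fun W => mul_nonneg (hν0 W) (hd0 W)) (fun W => mul_nonneg (hν0 W) (hd'0 W)) (fun W => mul_nonneg (hν0 W) (hd0 W)) (fun W => mul_nonneg (hν0 W) (hd'0 W))
    (fun W => (m ∈ W ∧ j ∈ W ∧ j' ∈ W)) (fun W => (m ∈ W ∧ j ∈ W ∧ j' ∉ W)) (fun W => (m ∈ W ∧ j ∈ W ∧ j' ∉ W)) (fun W => (m ∈ W ∧ j ∈ W ∧ j' ∈ W))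
    (fun s hs t ht hA hB => by
      exact ⟨⟨(Finset.mem_inter.2 ⟨hA.1, hB.1⟩), (Finset.mem_inter.2 ⟨hA.2.1, hB.2.1⟩), (fun hh => hB.2.2 (Finset.mem_inter.1 hh).2)⟩, ⟨(Finset.mem_union_left _ hA.1), (Finset.mem_union_left _ hA.2.1), (Finset.mem_union_left _ hA.2.2)⟩, six_pw_dw U ν d d' hν0 hν hd0 hd'0 hdd' s hs t ht⟩)
  exact h

/-- The bound by the top fibre: `u_mjj'·w_mjp ≤ u_mjp·w_mjj'`. -/
lemma jp_top_mjp (U : Finset V) (m j j' : V)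
    (ν d d' : Finset V → R)
    (hν0 : ∀ W, 0 ≤ ν W) (hν : ∀ s ⊆ U, ∀ t ⊆ U, ν s * ν t ≤ ν (s ∩ t) * ν (s ∪ t))
    (hd0 : ∀ W, 0 ≤ d W) (hd'0 : ∀ W, 0 ≤ d' W)
    (hdd' : ∀ s t, d s * d' t ≤ d (s ∩ t) * d' (s ∪ t)) :
    (∑ W ∈ U.powerset.filter (fun W => m ∈ W ∧ j ∈ W ∧ j' ∈ W), ν W * d W) * (∑ W ∈ U.powerset.filter (fun W => m ∈ W ∧ j ∉ W ∧ j' ∈ W), ν W * d' W) ≤ (∑ W ∈ U.powerset.filter (fun W => m ∈ W ∧ j ∉ W ∧ j' ∈ W), ν W * d W) * (∑ W ∈ U.powerset.filter (fun W => m ∈ W ∧ j ∈ W ∧ j' ∈ W), ν W * d' W) := by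
  have h := ad_sets_dec U (fun W => ν W * d W) (fun W => ν W * d' W) (fun W => ν W * d W) (fun W => ν W * d' W)
    (fun W => mul_nonneg (hν0 W) (hd0 W)) (fun W => mul_nonneg (hν0 W) (hd'0 W)) (fun W => mul_nonneg (hν0 W) (hd0 W)) (fun W => mul_nonneg (hν0 W) (hd'0 W))
    (fun W => (m ∈ W ∧ j ∈ W ∧ j' ∈ W)) (fun W => (m ∈ W ∧ j ∉ W ∧ j' ∈ W)) (fun W => (m ∈ W ∧ j ∉ W ∧ j' ∈ W)) (fun W => (m ∈ W ∧ j ∈ W ∧ j' ∈ W))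
    (fun s hs t ht hA hB => by
      exact ⟨⟨(Finset.mem_inter.2 ⟨hA.1, hB.1⟩), (fun hh => hB.2.1 (Finset.mem_inter.1 hh).2), (Finset.mem_inter.2 ⟨hA.2.2, hB.2.2⟩)⟩, ⟨(Finset.mem_union_left _ hA.1), (Finset.mem_union_left _ hA.2.1), (Finset.mem_union_left _ hA.2.2)⟩, six_pw_dw U ν d d' hν0 hν hd0 hd'0 hdd' s hs t ht⟩)
  exact h

/-- The bound by the top fibre: `u_mjj'·w_jjp ≤ u_jjp·w_mjj'`. -/
lemma jp_top_jjp (U : Finset V) (m j j' : V)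
    (ν d d' : Finset V → R)
    (hν0 : ∀ W, 0 ≤ ν W) (hν : ∀ s ⊆ U, ∀ t ⊆ U, ν s * ν t ≤ ν (s ∩ t) * ν (s ∪ t))
    (hd0 : ∀ W, 0 ≤ d W) (hd'0 : ∀ W, 0 ≤ d' W)
    (hdd' : ∀ s t, d s * d' t ≤ d (s ∩ t) * d' (s ∪ t)) :
    (∑ W ∈ U.powerset.filter (fun W => m ∈ W ∧ j ∈ W ∧ j' ∈ W), ν W * d W) * (∑ W ∈ U.powerset.filter (fun W => m ∉ W ∧ j ∈ W ∧ j' ∈ W), ν W * d' W) ≤ (∑ W ∈ U.powerset.filter (fun W => m ∉ W ∧ j ∈ W ∧ j' ∈ W), ν W * d W) * (∑ W ∈ U.powerset.filter (fun W => m ∈ W ∧ j ∈ W ∧ j' ∈ W), ν W * d' W) := by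
  have h := ad_sets_dec U (fun W => ν W * d W) (fun W => ν W * d' W) (fun W => ν W * d W) (fun W => ν W * d' W)
    (fun W => mul_nonneg (hν0 W) (hd0 W)) (fun W => mul_nonneg (hν0 W) (hd'0 W)) (fun W => mul_nonneg (hν0 W) (hd0 W)) (fun W => mul_nonneg (hν0 W) (hd'0 W))
    (fun W => (m ∈ W ∧ j ∈ W ∧ j' ∈ W)) (fun W => (m ∉ W ∧ j ∈ W ∧ j' ∈ W)) (fun W => (m ∉ W ∧ j ∈ W ∧ j' ∈ W)) (fun W => (m ∈ W ∧ j ∈ W ∧ j' ∈ W))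
    (fun s hs t ht hA hB => by
      exact ⟨⟨(fun hh => hB.1 (Finset.mem_inter.1 hh).2), (Finset.mem_inter.2 ⟨hA.2.1, hB.2.1⟩), (Finset.mem_inter.2 ⟨hA.2.2, hB.2.2⟩)⟩, ⟨(Finset.mem_union_left _ hA.1), (Finset.mem_union_left _ hA.2.1), (Finset.mem_union_left _ hA.2.2)⟩, six_pw_dw U ν d d' hν0 hν hd0 hd'0 hdd' s hs t ht⟩)
  exact h

/-- The resource fact: the gate's own log-supermodularity `w_mj·w_mj' ≤ w_m·w_mjj'`. -/
lemma jp_res6 (U : Finset V) (m j j' : V)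
    (ν d' : Finset V → R)
    (hν0 : ∀ W, 0 ≤ ν W) (hν : ∀ s ⊆ U, ∀ t ⊆ U, ν s * ν t ≤ ν (s ∩ t) * ν (s ∪ t))
    (hd'0 : ∀ W, 0 ≤ d' W)
    (hd'd' : ∀ s t, d' s * d' t ≤ d' (s ∩ t) * d' (s ∪ t)) :
    (∑ W ∈ U.powerset.filter (fun W => m ∈ W ∧ j ∈ W ∧ j' ∉ W), ν W * d' W) * (∑ W ∈ U.powerset.filter (fun W => m ∈ W ∧ j ∉ W ∧ j' ∈ W), ν W * d' W) ≤ (∑ W ∈ U.powerset.filter (fun W => m ∈ W ∧ j ∉ W ∧ j' ∉ W), ν W * d' W) * (∑ W ∈ U.powerset.filter (fun W => m ∈ W ∧ j ∈ W ∧ j' ∈ W), ν W * d' W) := by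
  have h := ad_sets_dec U (fun W => ν W * d' W) (fun W => ν W * d' W) (fun W => ν W * d' W) (fun W => ν W * d' W)
    (fun W => mul_nonneg (hν0 W) (hd'0 W)) (fun W => mul_nonneg (hν0 W) (hd'0 W)) (fun W => mul_nonneg (hν0 W) (hd'0 W)) (fun W => mul_nonneg (hν0 W) (hd'0 W))
    (fun W => (m ∈ W ∧ j ∈ W ∧ j' ∉ W)) (fun W => (m ∈ W ∧ j ∉ W ∧ j' ∈ W)) (fun W => (m ∈ W ∧ j ∉ W ∧ j' ∉ W)) (fun W => (m ∈ W ∧ j ∈ W ∧ j' ∈ W))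
    (fun s hs t ht hA hB => by
      exact ⟨⟨(Finset.mem_inter.2 ⟨hA.1, hB.1⟩), (fun hh => hB.2.1 (Finset.mem_inter.1 hh).2), (fun hh => hA.2.2 (Finset.mem_inter.1 hh).1)⟩, ⟨(Finset.mem_union_left _ hA.1), (Finset.mem_union_left _ hA.2.1), (Finset.mem_union_right _ hB.2.2)⟩, six_pw_ww U ν d' hν0 hν hd'0 hd'd' s hs t ht⟩)
  exact h

end JpGateFacts

end Summit.Ventures.PercRepro2.Coin
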